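import Summits.MatrixMultiplication.MatrixMultiplication.Theorems.SoloBlindMassCalculus

/-!
# The complementary cube-pair lemma (contraction + pair identity)

Sub-programme (K₃) / Conjecture E, K3.24.5.  Let `h` be zero-sum free on `S`, `τ` H-good, `T₀ ⊆ S` a representation of
`τ`, `W = S \ T₀`, and `T₀ = B ⊔ B'` a split into two non-empty parts (`B' = T₀ \ B`).  CONTRACT `B` to one index `b ∈ B`
carrying the value `∑_B h` and `B'` to one index `b' ∈ B'` carrying `∑_{B'} h` (`soloBlindContract`); on
`S' = W ∪ {b, b'}` the contracted map is again zero-sum free (`soloBlind_contract_zsf`) and `τ` is again H-good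
(`soloBlind_contract_hgood`) — every sub-sum of the contraction is a sub-sum of `h` over a subset of `S`
(`soloBlind_contract_expand`) — and `{b, b'}` is a pair representation of `τ`.  The exact pair identity
(`soloBlind_conjE_pair_iff`) then turns `E(τ; S') ≤ 1/2` into the COMPLEMENTARY CUBE-PAIR INEQUALITY
  `K(∑_B h; W) + K(τ - ∑_B h; W) ≤ 1/2`       (`soloBlind_cube_pair`, `soloBlind_cube_pair_of_conjE`),
i.e. in the cube identity `E(τ;S) = 2^{-m} ∑_{B ⊆ T₀} 2^{|B|} e(B)` complementary cube masses pair up to at most `1/2`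
(tight in the data of ranks 4–5).  For `|T₀| = 3` this gives `∑ singles + ∑ doubles ≤ 3/2`; Conjecture E there needs
`2 ∑ singles + 4 ∑ doubles + 8 e(T₀) ≤ 3` (Q-K56).
-/

namespace Summit.MatrixMultiplication.MatrixMultiplication.Theorems

open Finset

universe u

variable {ι : Type*} [DecidableEq ι]
variable {G : Type u} [AddCommGroup G] [DecidableEq G]

omit [DecidableEq ι] in
/-- Kraft masses depend only on the values of `h` on `S`. -/
theorem soloBlind_mass_congr {h h' : ι → G} {S : Finset ι} (hh : ∀ i ∈ S, h' i = h i) (τ : G) :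
    soloBlindMass h' S τ = soloBlindMass h S τ := by
  have key : soloBlindSeqRepAll h' S τ = soloBlindSeqRepAll h S τ := by
    ext T
    rw [soloBlind_mem_seqRepAll, soloBlind_mem_seqRepAll]
    constructor
    · rintro ⟨hTS, hsum⟩
      exact ⟨hTS, by rw [← hsum]; exact (Finset.sum_congr rfl fun i hi => hh i (hTS hi)).symm⟩
    · rintro ⟨hTS, hsum⟩
      exact ⟨hTS, by rw [← hsum]; exact Finset.sum_congr rfl fun i hi => hh i (hTS hi)⟩
  rw [soloBlindMass, key, soloBlindMass]

omit [DecidableEq G] in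
/-- The contraction of `B` to the index `b` and of `B'` to the index `b'`. -/
def soloBlindContract (h : ι → G) (B B' : Finset ι) (b b' : ι) : ι → G :=
  fun i => if i = b then ∑ j ∈ B, h j else if i = b' then ∑ j ∈ B', h j else h i

omit [DecidableEq G] in
/-- Value of the contraction at `b`. -/
theorem soloBlindContract_fst (h : ι → G) (B B' : Finset ι) (b b' : ι) :
    soloBlindContract h B B' b b' b = ∑ j ∈ B, h j := by
  simp [soloBlindContract]

omit [DecidableEq G] in
/-- Value of the contraction at `b' ≠ b`. -/
theorem soloBlindContract_snd (h : ι → G) (B B' : Finset ι) {b b' : ι} (hne : b ≠ b') :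
    soloBlindContract h B B' b b' b' = ∑ j ∈ B', h j := by
  simp [soloBlindContract, hne.symm]

omit [DecidableEq G] in
/-- Value of the contraction off `b, b'`. -/
theorem soloBlindContract_of_ne (h : ι → G) (B B' : Finset ι) {b b' i : ι} (hi : i ≠ b) (hi' : i ≠ b') :
    soloBlindContract h B B' b b' i = h i := by
  simp [soloBlindContract, hi, hi']

omit [DecidableEq G] in
/-- Sub-sums of the contraction over any `T'` (`b ≠ b'`): the `b`-part, the `b'`-part and the rest. -/
theorem soloBlind_contract_sum (h : ι → G) (B B' : Finset ι) {b b' : ι} (hne : b ≠ b') (T' : Finset ι) :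
    ∑ i ∈ T', soloBlindContract h B B' b b' i =
      (if b ∈ T' then ∑ j ∈ B, h j else 0) + (if b' ∈ T' then ∑ j ∈ B', h j else 0) +
        ∑ i ∈ (T'.erase b).erase b', h i := by
  set c := soloBlindContract h B B' b b' with hc
  have hU : ∀ i ∈ (T'.erase b).erase b', c i = h i := by
    intro i hi
    rw [Finset.mem_erase, Finset.mem_erase] at hi
    exact soloBlindContract_of_ne h B B' hi.2.1 hi.1
  have step2 : ∑ i ∈ T'.erase b, c i = (if b' ∈ T' then ∑ j ∈ B', h j else 0) + ∑ i ∈ (T'.erase b).erase b', h i := by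
    by_cases hb' : b' ∈ T'
    · have hb'' : b' ∈ T'.erase b := Finset.mem_erase.mpr ⟨hne.symm, hb'⟩
      rw [if_pos hb', ← Finset.add_sum_erase _ _ hb'', hc, soloBlindContract_snd h B B' hne,
        Finset.sum_congr rfl hU]
    · have : (T'.erase b).erase b' = T'.erase b := Finset.erase_eq_of_notMem fun hm => hb' (Finset.mem_of_mem_erase hm)
      rw [if_neg hb', zero_add, ← Finset.sum_congr rfl hU, this]
  by_cases hb : b ∈ T'
  · rw [if_pos hb, ← Finset.add_sum_erase _ _ hb, hc, soloBlindContract_fst, ← hc, step2, add_assoc]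
  · have : T'.erase b = T' := Finset.erase_eq_of_notMem hb
    rw [if_neg hb, zero_add, ← step2, this]

omit [DecidableEq G] in
/-- EXPANSION: every sub-sum of the contraction over a subset `T'` of `(S \ T₀) ∪ {b, b'}` is the `h`-sum over a
subset `X ⊆ S`, non-empty if `T'` is (`B ⊆ T₀` non-empty via `b ∈ B`, `B' = T₀ \ B` non-empty via `b'`). -/
theorem soloBlind_contract_expand (h : ι → G) {S T₀ B : Finset ι} (hT₀S : T₀ ⊆ S) (hBT : B ⊆ T₀) {b b' : ι}
    (hb : b ∈ B) (hb' : b' ∈ T₀ \ B) {T' : Finset ι} (hT' : T' ⊆ insert b (insert b' (S \ T₀))) :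
    ∃ X ⊆ S, (T'.Nonempty → X.Nonempty) ∧
      ∑ i ∈ X, h i = ∑ i ∈ T', soloBlindContract h B (T₀ \ B) b b' i := by
  have hne : b ≠ b' := by
    rintro rfl; exact (Finset.mem_sdiff.mp hb').2 hb
  have hbW : b ∉ S \ T₀ := fun hm => (Finset.mem_sdiff.mp hm).2 (hBT hb)
  have hb'W : b' ∉ S \ T₀ := fun hm => (Finset.mem_sdiff.mp hm).2 (Finset.mem_sdiff.mp hb').1
  set U := (T'.erase b).erase b' with hUdef
  have hUW : U ⊆ S \ T₀ := by
    intro i hi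
    rw [hUdef, Finset.mem_erase, Finset.mem_erase] at hi
    have := hT' hi.2.2
    rw [Finset.mem_insert, Finset.mem_insert] at this
    rcases this with e | e | hm
    · exact absurd e hi.2.1
    · exact absurd e hi.1
    · exact hm
  set C := (if b ∈ T' then B else ∅) ∪ (if b' ∈ T' then T₀ \ B else ∅) with hCdef
  have hCT : C ⊆ T₀ := by
    refine Finset.union_subset ?_ ?_
    · split_ifs
      · exact hBT
      · exact Finset.empty_subset _
    · split_ifs
      · exact Finset.sdiff_subset
      · exact Finset.empty_subset _
  have hdisjUC : Disjoint U C := by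
    refine Finset.disjoint_left.mpr fun i hiU hiC => ?_
    exact (Finset.mem_sdiff.mp (hUW hiU)).2 (hCT hiC)
  have hdisjB : Disjoint (if b ∈ T' then B else ∅) (if b' ∈ T' then T₀ \ B else ∅) := by
    refine Finset.disjoint_left.mpr fun i hi1 hi2 => ?_
    split_ifs at hi1 hi2 <;> simp_all
  have hsumC : ∑ i ∈ C, h i = (if b ∈ T' then ∑ j ∈ B, h j else 0) + (if b' ∈ T' then ∑ j ∈ T₀ \ B, h j else 0) := by
    rw [hCdef, Finset.sum_union hdisjB]
    congr 1
    · split_ifs <;> simp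
    · split_ifs <;> simp
  refine ⟨U ∪ C, Finset.union_subset (hUW.trans Finset.sdiff_subset) (hCT.trans hT₀S), ?_, ?_⟩
  · rintro ⟨i, hi⟩
    by_cases hib : i = b
    · subst hib
      refine ⟨i, Finset.mem_union_right _ ?_⟩
      rw [hCdef]; exact Finset.mem_union_left _ (by rw [if_pos hi]; exact hb)
    by_cases hib' : i = b'
    · subst hib'
      refine ⟨i, Finset.mem_union_right _ ?_⟩
      rw [hCdef]; exact Finset.mem_union_right _ (by rw [if_pos hi]; exact hb')
    · exact ⟨i, Finset.mem_union_left _ (Finset.mem_erase.mpr ⟨hib', Finset.mem_erase.mpr ⟨hib, hi⟩⟩)⟩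
  · rw [Finset.sum_union hdisjUC, hsumC, soloBlind_contract_sum h B (T₀ \ B) hne T', hUdef]
    abel

omit [DecidableEq G] in
/-- The contraction is zero-sum free on `(S \ T₀) ∪ {b, b'}`. -/
theorem soloBlind_contract_zsf {h : ι → G} {S : Finset ι}
    (zsf : ∀ T ⊆ S, T.Nonempty → ∑ i ∈ T, h i ≠ 0) {T₀ B : Finset ι} (hT₀S : T₀ ⊆ S) (hBT : B ⊆ T₀)
    {b b' : ι} (hb : b ∈ B) (hb' : b' ∈ T₀ \ B) :
    ∀ T' ⊆ insert b (insert b' (S \ T₀)), T'.Nonempty →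
      ∑ i ∈ T', soloBlindContract h B (T₀ \ B) b b' i ≠ 0 := by
  intro T' hT' hne hsum
  obtain ⟨X, hXS, hXne, hX⟩ := soloBlind_contract_expand h hT₀S hBT hb hb' hT'
  exact zsf X hXS (hXne hne) (hX.trans hsum)

omit [DecidableEq G] in
/-- `τ` stays H-good for the contraction. -/
theorem soloBlind_contract_hgood {h : ι → G} {S : Finset ι} {τ : G}
    (hgood : ∀ T ⊆ S, ∑ i ∈ T, h i ≠ τ + τ) {T₀ B : Finset ι} (hT₀S : T₀ ⊆ S) (hBT : B ⊆ T₀)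
    {b b' : ι} (hb : b ∈ B) (hb' : b' ∈ T₀ \ B) :
    ∀ T' ⊆ insert b (insert b' (S \ T₀)), ∑ i ∈ T', soloBlindContract h B (T₀ \ B) b b' i ≠ τ + τ := by
  intro T' hT' hsum
  obtain ⟨X, hXS, -, hX⟩ := soloBlind_contract_expand h hT₀S hBT hb hb' hT'
  exact hgood X hXS (hX.trans hsum)

/-- THE COMPLEMENTARY CUBE-PAIR LEMMA (hypothesis form): if Conjecture E holds for the contracted configuration, then
`K(∑_B h; W) + K(τ - ∑_B h; W) ≤ 1/2`, `W = S \ T₀`. -/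
theorem soloBlind_cube_pair {h : ι → G} {S : Finset ι}
    (zsf : ∀ T ⊆ S, T.Nonempty → ∑ i ∈ T, h i ≠ 0) {τ : G} (hgood : ∀ T ⊆ S, ∑ i ∈ T, h i ≠ τ + τ)
    {T₀ B : Finset ι} (hT₀S : T₀ ⊆ S) (hT₀ : ∑ i ∈ T₀, h i = τ) (hBT : B ⊆ T₀)
    {b b' : ι} (hb : b ∈ B) (hb' : b' ∈ T₀ \ B)
    (hE : soloBlindMass (soloBlindContract h B (T₀ \ B) b b') (insert b (insert b' (S \ T₀))) τ ≤ 1 / 2) :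
    soloBlindMass h (S \ T₀) (∑ i ∈ B, h i) + soloBlindMass h (S \ T₀) (τ - ∑ i ∈ B, h i) ≤ 1 / 2 := by
  have hne : b ≠ b' := by
    rintro rfl; exact (Finset.mem_sdiff.mp hb').2 hb
  have hbW : b ∉ S \ T₀ := fun hm => (Finset.mem_sdiff.mp hm).2 (hBT hb)
  have hb'W : b' ∉ S \ T₀ := fun hm => (Finset.mem_sdiff.mp hm).2 (Finset.mem_sdiff.mp hb').1
  have zsf' := soloBlind_contract_zsf zsf hT₀S hBT hb hb'
  have hgood' := soloBlind_contract_hgood hgood hT₀S hBT hb hb'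
  have hbS' : b ∈ insert b (insert b' (S \ T₀)) := Finset.mem_insert_self _ _
  have hb'S' : b' ∈ insert b (insert b' (S \ T₀)) := Finset.mem_insert_of_mem (Finset.mem_insert_self _ _)
  have hsplit : ∑ i ∈ B, h i + ∑ i ∈ T₀ \ B, h i = τ := by
    rw [← Finset.sum_union (Finset.disjoint_sdiff), Finset.union_sdiff_of_subset hBT, hT₀]
  have hpair : soloBlindContract h B (T₀ \ B) b b' b + soloBlindContract h B (T₀ \ B) b b' b' = τ := by
    rw [soloBlindContract_fst, soloBlindContract_snd h B (T₀ \ B) hne, hsplit]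
  have hW : ((insert b (insert b' (S \ T₀))).erase b).erase b' = S \ T₀ := by
    rw [Finset.erase_insert (by rw [Finset.mem_insert]; rintro (e | hm); exacts [hne e, hbW hm]),
      Finset.erase_insert hb'W]
  have key := (soloBlind_conjE_pair_iff zsf' hgood' hbS' hb'S' hne hpair).mp hE
  rw [hW, soloBlindContract_fst, soloBlindContract_snd h B (T₀ \ B) hne] at key
  have hcongr : ∀ i ∈ S \ T₀, soloBlindContract h B (T₀ \ B) b b' i = h i := fun i hi =>
    soloBlindContract_of_ne h B (T₀ \ B) (fun e => hbW (e ▸ hi)) (fun e => hb'W (e ▸ hi))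
  rw [soloBlind_mass_congr hcongr, soloBlind_mass_congr hcongr] at key
  have e2 : ∑ i ∈ T₀ \ B, h i = τ - ∑ i ∈ B, h i := by rw [← hsplit, add_sub_cancel_left]
  rwa [e2] at key

/-- THE COMPLEMENTARY CUBE-PAIR LEMMA (Conjecture-E form): if `E(τ'; S') ≤ 1/2` for every zero-sum-free `h'` on an
`S'` with `S'.card ≤ S.card` and every H-good `τ'` (Conjecture E up to the size of `S`, same group and index type),
then for every representation `T₀` of the H-good `τ` and every split `T₀ = B ⊔ (T₀ \ B)` with both parts non-empty:
`K(∑_B h; S \ T₀) + K(τ - ∑_B h; S \ T₀) ≤ 1/2`. -/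
theorem soloBlind_cube_pair_of_conjE {h : ι → G} {S : Finset ι}
    (hE : ∀ (h' : ι → G) (S' : Finset ι) (τ' : G), S'.card ≤ S.card →
      (∀ T ⊆ S', T.Nonempty → ∑ i ∈ T, h' i ≠ 0) → (∀ T ⊆ S', ∑ i ∈ T, h' i ≠ τ' + τ') →
      soloBlindMass h' S' τ' ≤ 1 / 2)
    (zsf : ∀ T ⊆ S, T.Nonempty → ∑ i ∈ T, h i ≠ 0) {τ : G} (hgood : ∀ T ⊆ S, ∑ i ∈ T, h i ≠ τ + τ)
    {T₀ B : Finset ι} (hT₀S : T₀ ⊆ S) (hT₀ : ∑ i ∈ T₀, h i = τ) (hBT : B ⊆ T₀)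
    {b b' : ι} (hb : b ∈ B) (hb' : b' ∈ T₀ \ B) :
    soloBlindMass h (S \ T₀) (∑ i ∈ B, h i) + soloBlindMass h (S \ T₀) (τ - ∑ i ∈ B, h i) ≤ 1 / 2 := by
  have hne : b ≠ b' := by
    rintro rfl; exact (Finset.mem_sdiff.mp hb').2 hb
  have hbW : b ∉ S \ T₀ := fun hm => (Finset.mem_sdiff.mp hm).2 (hBT hb)
  have hb'W : b' ∉ S \ T₀ := fun hm => (Finset.mem_sdiff.mp hm).2 (Finset.mem_sdiff.mp hb').1
  refine soloBlind_cube_pair zsf hgood hT₀S hT₀ hBT hb hb' (hE _ _ _ ?_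
    (soloBlind_contract_zsf zsf hT₀S hBT hb hb') (soloBlind_contract_hgood hgood hT₀S hBT hb hb'))
  -- card: |W| + 2 ≤ |S| because b, b' ∈ T₀ ⊆ S are distinct and not in W
  have hb'ins : b ∉ insert b' (S \ T₀) := by
    rw [Finset.mem_insert]; rintro (e | hm); exacts [hne e, hbW hm]
  rw [Finset.card_insert_of_notMem hb'ins, Finset.card_insert_of_notMem hb'W,
    Finset.card_sdiff_of_subset hT₀S]
  have h2 : 2 ≤ T₀.card := by
    have hsub : ({b, b'} : Finset ι) ⊆ T₀ :=
      Finset.insert_subset (hBT hb) (Finset.singleton_subset_iff.mpr (Finset.mem_sdiff.mp hb').1)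
    have := Finset.card_le_card hsub
    rw [Finset.card_pair hne] at this
    exact this
  have h3 : T₀.card ≤ S.card := Finset.card_le_card hT₀S
  omega

end Summit.MatrixMultiplication.MatrixMultiplication.Theorems
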